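import Mathlib.Analysis.SpecialFunctions.Pow.Real
import Mathlib.Analysis.SpecialFunctions.Sqrt
import HarnessLib

/-!
# The Bogoliubov angles of the low-momentum modes: `tanh(2τ_p) = -g/(ε_p + g)`

Topic `Literature/MathematicalPhysics/QuantumManyBody`; scalar input for the provefact
`Literature.MathematicalPhysics.QuantumManyBody.BoseGas.BastiCenatiempoSchlein2021_upperBound`
((2.10)–(2.11) and (eq:sL2) of [BastiCenatiempoSchlein2021], with `p² ↦ ε`, `8π𝔞N^κ ↦ g`).

For a kinetic energy `ε > 0` and a coupling `g > 0` the pair amplitude `t = tanh τ` of the mode is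
the root in `(-1, 0]` of `tanh(2τ) = 2t/(1+t²) = -x`, `x = g/(ε+g)`:
`bogTanh g ε = -x/(1 + √(1-x²))`. With `R = √(ε² + 2gε)`:

* `two_mul_bogTanh_div` — `2t/(1+t²) = -g/(ε+g)`;
* `bogTanh_sq_div` — `σ² = t²/(1-t²) = (ε + g - R)/(2R)`;
* `bogTanh_div` — `γσ = t/(1-t²) = -g/(2R)`;
* `sinhSq_add_mul` — the identity `εσ² + (σ² + γσ)G = ½[(ε² + ε(g+G))/R - ε - G]` behind (3.?) of
  [ibid., p. 13] (with `G = g`: `½[R - ε - g]`, the summand of the Bogoliubov ground state energy);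
* bounds `σ² ≤ g²/(2ε² + 4gε)`, `|γσ| ≤ g/(2R)` (the source of `‖σ_L‖_∞² ≤ CN^{κ/2}` etc.).

## References

* [BastiCenatiempoSchlein2021] G. Basti, S. Cenatiempo, B. Schlein, Forum Math. Sigma 9 (2021) e74,
  arXiv:2101.06222: (2.10)–(2.11), Lemma 2.2 and (eq:sL2) in its proof, p. 13.
-/

noncomputable section

namespace Literature.MathematicalPhysics.QuantumManyBody.BoseGas

/-- **The pair amplitude of a low-momentum mode**: the solution `t = tanh τ ∈ (-1, 0]` of
`tanh(2τ) = -g/(ε + g)`, namely `t = -x/(1 + √(1 - x²))`, `x = g/(ε+g)`.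
[cite: BastiCenatiempoSchlein2021, (2.10) (`tanh(2τ_p) = -8π𝔞N^κ/(p² + 8π𝔞N^κ)`)] -/
def bogTanh (g ε : ℝ) : ℝ :=
  -(g / (ε + g)) / (1 + Real.sqrt (1 - (g / (ε + g)) ^ 2))

section Angles

variable {g ε : ℝ}

/-- `0 ≤ x = g/(ε+g) < 1` for `ε > 0`, `g ≥ 0`. [folklore] -/
theorem ratio_nonneg_lt_one (hε : 0 < ε) (hg : 0 ≤ g) : 0 ≤ g / (ε + g) ∧ g / (ε + g) < 1 := by
  have h : 0 < ε + g := by linarith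
  refine ⟨div_nonneg hg h.le, ?_⟩
  rw [div_lt_one h]; linarith

/-- `R = √(ε² + 2gε) > 0`. [folklore] -/
theorem sqrt_dispersion_pos (hε : 0 < ε) (hg : 0 ≤ g) : 0 < Real.sqrt (ε ^ 2 + 2 * g * ε) :=
  Real.sqrt_pos.2 (by positivity)

/-- `ε ≤ R ≤ ε + g`. [folklore] -/
theorem sqrt_dispersion_bounds (hε : 0 < ε) (hg : 0 ≤ g) :
    ε ≤ Real.sqrt (ε ^ 2 + 2 * g * ε) ∧ Real.sqrt (ε ^ 2 + 2 * g * ε) ≤ ε + g := by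
  constructor
  · exact (Real.le_sqrt hε.le (by positivity)).2 (by nlinarith)
  · rw [show ε + g = Real.sqrt ((ε + g) ^ 2) from (Real.sqrt_sq (by linarith)).symm]
    exact Real.sqrt_le_sqrt (by nlinarith)

/-- The key square root: `√(1 - x²) = R/(ε+g)`, `R = √(ε²+2gε)`. [folklore] -/
theorem sqrt_one_sub_ratio_sq (hε : 0 < ε) (hg : 0 ≤ g) :
    Real.sqrt (1 - (g / (ε + g)) ^ 2) = Real.sqrt (ε ^ 2 + 2 * g * ε) / (ε + g) := by
  have h : 0 < ε + g := by linarith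
  have heq : 1 - (g / (ε + g)) ^ 2 = (ε ^ 2 + 2 * g * ε) / (ε + g) ^ 2 := by
    field_simp; ring
  rw [heq, Real.sqrt_div (by positivity), Real.sqrt_sq h.le]

/-- The algebra of `t = -x/(1+s)` with `s² = 1 - x²`, `s > 0`: `1 + t² = 2/(1+s)`,
`1 - t² = 2s/(1+s)`, `t²/(1-t²) = (1-s)/(2s)`, `t/(1-t²) = -x/(2s)`. [folklore] -/
theorem tanh_half_algebra {x s : ℝ} (hs : 0 < s) (hs2 : s ^ 2 = 1 - x ^ 2) :
    1 + (-x / (1 + s)) ^ 2 = 2 / (1 + s) ∧ 1 - (-x / (1 + s)) ^ 2 = 2 * s / (1 + s) ∧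
      (-x / (1 + s)) ^ 2 / (1 - (-x / (1 + s)) ^ 2) = (1 - s) / (2 * s) ∧
      (-x / (1 + s)) / (1 - (-x / (1 + s)) ^ 2) = -x / (2 * s) := by
  have h1s : 0 < 1 + s := by linarith
  have hx2 : x ^ 2 = 1 - s ^ 2 := by linarith
  have hA : 1 + (-x / (1 + s)) ^ 2 = 2 / (1 + s) := by
    rw [div_pow, neg_sq, hx2]; field_simp; ring
  have hB : 1 - (-x / (1 + s)) ^ 2 = 2 * s / (1 + s) := by
    rw [div_pow, neg_sq, hx2]; field_simp; ring
  refine ⟨hA, hB, ?_, ?_⟩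
  · rw [hB, div_pow, neg_sq, hx2]; field_simp; ring
  · rw [hB]; field_simp

/-- The defining relation `2t/(1+t²) = -g/(ε+g)` (`tanh 2τ` in terms of `t = tanh τ`).
[cite: BastiCenatiempoSchlein2021, (2.10)] -/
theorem two_mul_bogTanh_div (hε : 0 < ε) (hg : 0 ≤ g) :
    2 * bogTanh g ε / (1 + bogTanh g ε ^ 2) = -(g / (ε + g)) := by
  have h : 0 < ε + g := by linarith
  have hR := sqrt_dispersion_pos hε hg
  have hs : 0 < Real.sqrt (ε ^ 2 + 2 * g * ε) / (ε + g) := by positivity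
  have hs2 : (Real.sqrt (ε ^ 2 + 2 * g * ε) / (ε + g)) ^ 2 = 1 - (g / (ε + g)) ^ 2 := by
    rw [div_pow, Real.sq_sqrt (by positivity)]; field_simp; ring
  obtain ⟨hA, -, -, -⟩ := tanh_half_algebra hs hs2
  unfold bogTanh
  rw [sqrt_one_sub_ratio_sq hε hg, hA]
  have h1s : 0 < 1 + Real.sqrt (ε ^ 2 + 2 * g * ε) / (ε + g) := by positivity
  field_simp

/-- `|t| < 1`. [folklore] -/
theorem abs_bogTanh_lt_one (hε : 0 < ε) (hg : 0 ≤ g) : |bogTanh g ε| < 1 := by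
  obtain ⟨hx0, hx1⟩ := ratio_nonneg_lt_one hε hg
  set x := g / (ε + g) with hx
  have hs0 : 0 ≤ Real.sqrt (1 - x ^ 2) := Real.sqrt_nonneg _
  unfold bogTanh
  rw [← hx, abs_div, abs_neg, abs_of_nonneg hx0, abs_of_pos (by linarith), div_lt_one (by linarith)]
  linarith

/-- `t ≤ 0`. [folklore] -/
theorem bogTanh_nonpos (hε : 0 < ε) (hg : 0 ≤ g) : bogTanh g ε ≤ 0 := by
  obtain ⟨hx0, hx1⟩ := ratio_nonneg_lt_one hε hg
  unfold bogTanh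
  have hs0 : 0 ≤ Real.sqrt (1 - (g / (ε + g)) ^ 2) := Real.sqrt_nonneg _
  exact div_nonpos_of_nonpos_of_nonneg (neg_nonpos.2 hx0) (by linarith)

/-- **`σ² = t²/(1-t²) = (ε + g - R)/(2R)`**, `R = √(ε²+2gε)`.
[cite: BastiCenatiempoSchlein2021, proof of Lemma 2.2 (eq:sL2)] -/
theorem bogTanh_sq_div (hε : 0 < ε) (hg : 0 ≤ g) :
    bogTanh g ε ^ 2 / (1 - bogTanh g ε ^ 2) =
      (ε + g - Real.sqrt (ε ^ 2 + 2 * g * ε)) / (2 * Real.sqrt (ε ^ 2 + 2 * g * ε)) := by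
  have h : 0 < ε + g := by linarith
  have hR := sqrt_dispersion_pos hε hg
  have hs : 0 < Real.sqrt (ε ^ 2 + 2 * g * ε) / (ε + g) := by positivity
  have hs2 : (Real.sqrt (ε ^ 2 + 2 * g * ε) / (ε + g)) ^ 2 = 1 - (g / (ε + g)) ^ 2 := by
    rw [div_pow, Real.sq_sqrt (by positivity)]; field_simp; ring
  obtain ⟨-, -, hC, -⟩ := tanh_half_algebra hs hs2
  unfold bogTanh
  rw [sqrt_one_sub_ratio_sq hε hg, hC]
  field_simp

/-- **`γσ = t/(1-t²) = -g/(2R)`**. [cite: BastiCenatiempoSchlein2021, proof of Lemma 2.2 (eq:sL2)] -/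
theorem bogTanh_div (hε : 0 < ε) (hg : 0 ≤ g) :
    bogTanh g ε / (1 - bogTanh g ε ^ 2) = -g / (2 * Real.sqrt (ε ^ 2 + 2 * g * ε)) := by
  have h : 0 < ε + g := by linarith
  have hR := sqrt_dispersion_pos hε hg
  have hs : 0 < Real.sqrt (ε ^ 2 + 2 * g * ε) / (ε + g) := by positivity
  have hs2 : (Real.sqrt (ε ^ 2 + 2 * g * ε) / (ε + g)) ^ 2 = 1 - (g / (ε + g)) ^ 2 := by
    rw [div_pow, Real.sq_sqrt (by positivity)]; field_simp; ring
  obtain ⟨-, -, -, hD⟩ := tanh_half_algebra hs hs2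
  unfold bogTanh
  rw [sqrt_one_sub_ratio_sq hε hg, hD]
  field_simp

/-- **The resummation identity of [ibid., p. 13]**: for any `G`,
`εσ² + (σ² + γσ)G = ½[(ε² + ε(g+G))/R - ε - G]` when `σ² = (ε+g-R)/(2R)`, `γσ = -g/(2R)`,
`R = √(ε²+2gε)`. [cite: BastiCenatiempoSchlein2021, p. 13 (first display after (eq:Vastf))] -/
theorem sinhSq_add_mul (hε : 0 < ε) (hg : 0 ≤ g) (G : ℝ) :
    ε * ((ε + g - Real.sqrt (ε ^ 2 + 2 * g * ε)) / (2 * Real.sqrt (ε ^ 2 + 2 * g * ε))) +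
      ((ε + g - Real.sqrt (ε ^ 2 + 2 * g * ε)) / (2 * Real.sqrt (ε ^ 2 + 2 * g * ε)) +
        -g / (2 * Real.sqrt (ε ^ 2 + 2 * g * ε))) * G =
      ((ε ^ 2 + ε * (g + G)) / Real.sqrt (ε ^ 2 + 2 * g * ε) - ε - G) / 2 := by
  have hR := sqrt_dispersion_pos hε hg
  set R := Real.sqrt (ε ^ 2 + 2 * g * ε) with hRdef
  field_simp
  ring

/-- With `G = g` the identity becomes the Bogoliubov summand `½[R - ε - g]`.
[cite: BastiCenatiempoSchlein2021, p. 13] -/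
theorem sinhSq_add_mul_self (hε : 0 < ε) (hg : 0 ≤ g) :
    ε * ((ε + g - Real.sqrt (ε ^ 2 + 2 * g * ε)) / (2 * Real.sqrt (ε ^ 2 + 2 * g * ε))) +
      ((ε + g - Real.sqrt (ε ^ 2 + 2 * g * ε)) / (2 * Real.sqrt (ε ^ 2 + 2 * g * ε)) +
        -g / (2 * Real.sqrt (ε ^ 2 + 2 * g * ε))) * g =
      (Real.sqrt (ε ^ 2 + 2 * g * ε) - ε - g) / 2 := by
  rw [sinhSq_add_mul hε hg g]
  have hR := sqrt_dispersion_pos hε hg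
  have hR2 : Real.sqrt (ε ^ 2 + 2 * g * ε) ^ 2 = ε ^ 2 + 2 * g * ε := Real.sq_sqrt (by positivity)
  set R := Real.sqrt (ε ^ 2 + 2 * g * ε) with hRdef
  have hnum : ε ^ 2 + ε * (g + g) = R ^ 2 := by rw [hR2]; ring
  rw [hnum, pow_two, mul_self_div_self]

/-- **`σ² ≤ g²/(2ε² + 4gε)`** (`= g²/(2R²)`): the two regimes `σ² ≲ g/ε` (`ε ≲ g`) and `σ² ≲ g²/ε²`
(`ε ≳ g`) of the proof of Lemma 2.2. [cite: BastiCenatiempoSchlein2021, proof of Lemma 2.2] -/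
theorem sinhSq_le (hε : 0 < ε) (hg : 0 ≤ g) :
    (ε + g - Real.sqrt (ε ^ 2 + 2 * g * ε)) / (2 * Real.sqrt (ε ^ 2 + 2 * g * ε)) ≤
      g ^ 2 / (2 * ε ^ 2 + 4 * g * ε) := by
  have hR := sqrt_dispersion_pos hε hg
  have hR2 : Real.sqrt (ε ^ 2 + 2 * g * ε) ^ 2 = ε ^ 2 + 2 * g * ε := Real.sq_sqrt (by positivity)
  obtain ⟨hεR, hRle⟩ := sqrt_dispersion_bounds hε hg
  set R := Real.sqrt (ε ^ 2 + 2 * g * ε) with hRdef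
  have hden : 2 * ε ^ 2 + 4 * g * ε = 2 * R ^ 2 := by rw [hR2]; ring
  rw [hden, div_le_div_iff₀ (by positivity) (by positivity)]
  have h1 : (ε + g - R) * R ≤ g ^ 2 := by nlinarith [hR2, hRle]
  nlinarith [h1]

/-- `σ² ≥ 0`. [folklore] -/
theorem sinhSq_nonneg (hε : 0 < ε) (hg : 0 ≤ g) :
    0 ≤ (ε + g - Real.sqrt (ε ^ 2 + 2 * g * ε)) / (2 * Real.sqrt (ε ^ 2 + 2 * g * ε)) := by
  have hR := sqrt_dispersion_pos hε hg
  obtain ⟨-, hRle⟩ := sqrt_dispersion_bounds hε hg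
  exact div_nonneg (by linarith) (by positivity)

/-- **`|γσ| = g/(2R)`: `g/(2R) ≤ g/(2ε)` and `(g/(2R))² ≤ g/(8ε)`** — the bounds
`|γ_pσ_p| ≲ min(N^κ/p², N^{κ/2}/|p|)`. [cite: BastiCenatiempoSchlein2021, proof of Lemma 2.2] -/
theorem coshSinh_bounds (hε : 0 < ε) (hg : 0 ≤ g) :
    g / (2 * Real.sqrt (ε ^ 2 + 2 * g * ε)) ≤ g / (2 * ε) ∧
      (g / (2 * Real.sqrt (ε ^ 2 + 2 * g * ε))) ^ 2 ≤ g / (8 * ε) := by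
  have hR := sqrt_dispersion_pos hε hg
  have hR2 : Real.sqrt (ε ^ 2 + 2 * g * ε) ^ 2 = ε ^ 2 + 2 * g * ε := Real.sq_sqrt (by positivity)
  obtain ⟨hεR, -⟩ := sqrt_dispersion_bounds hε hg
  set R := Real.sqrt (ε ^ 2 + 2 * g * ε) with hRdef
  constructor
  · exact div_le_div_of_nonneg_left hg (by positivity) (by linarith)
  · rw [div_pow, div_le_div_iff₀ (by positivity) (by positivity)]
    nlinarith [hR2]

end Angles

end Literature.MathematicalPhysics.QuantumManyBody.BoseGas

end
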